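import Summits.ValiantsHypothesis.ValiantsHypothesis.Theorems.LacunarySymmetroidMatrixDescartesDoorA26WallBubblingMixedParity
import Summits.ValiantsHypothesis.ValiantsHypothesis.Theorems.LacunarySymmetroidMatrixDescartesDoorA26WallBubblingBubblingInertiaClosed

/-!
# Wall bubbling for `DoorA26` — the PM3 ROW: principal `3 × 3` minors of a realisable Gram matrix all carry ONE sign (kernel soundness item)

LINE / STUBS.  Crux `Theses.LacunarySymmetroid.DoorA26` (stmt-ValiantsHypothesis-19979; OPEN, typed, never asserted), line
`Cruxes/DoorA26/Lines/wall_bubbling.lean` (val-idea-15), obligation (M) `Stmt.stub_mixedWalls`.  After the hard-core read-out (kit j314458, desk R2742: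
the (M)-sieve of record leaves «STAIRCASE» survivors at every surviving middle wall) the line lead proposed a NEW row for the sieve, **PM3 = signed
principal 3-minors** (bus 2026-08-28T19:05Z; crit-5 19:06Z: «the real-algebra row is sound»): for `G = Uᵀ J U` with letters in `(ℝ³, J)`, `J` of
signature `(1,2)`, every principal `3 × 3` minor is `det(U_S)² · det J` — so ALL principal 3-minors of a realisable would-be Gram matrix carry ONE
sign (that of the global `ε`) or vanish, and a top valuation class of such a minor whose monomials all carry the forbidden sign can neither cancel
nor vanish.  This file is that row's SOUNDNESS ITEM in the kernel (def-free), before any PM3 kill is counted — exactly as W1 #3/#7 (SSR) and #8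
(Farkas) did for the rows of record:

* `det_principal_three_of_shape` — for `G = ε • (v vᵀ − u uᵀ − w wᵀ)` and ANY selection `S : Fin 3 → Fin 6`:
  `det (G.submatrix S S) = ε³ · det((Matrix.of ![v,u,w]).submatrix id S)²` (Cauchy–Binet with one 3-subset = `det_mul` on the `Bᵀ D B` factor);
* `principal_three_sign_of_shape` — hence `0 ≤ ε · det (G.submatrix S S)` for `ε = ±1`;
* **`realisable_principal_three_sign`** — for the line's `Realisable G`: `∃ ε, (ε = 1 ∨ ε = −1) ∧ ∀ S, 0 ≤ ε · det (G.submatrix S S)`;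
* `realisable_principal_three_mul_nonneg` — the `ε`-free form: any two principal 3-minors have non-negative product (same sign or zero);
* `principal_three_sign_persists` — sequence form for the sieve: along realisable `G^ν`, a principal 3-minor cannot be eventually of BOTH strict signs
  on two selections (the tropical «top class of forbidden sign» contradiction is an instance).

HONEST LIMITS.  A necessary condition only (constraints added to the sieve; old kills untouched); no facet certified, no census numeral; PM3's
EFFECT on the hard core is the line lead's pilot to measure (PRED to be sealed first, crit-5 (p3)).  Nothing here bears on (M)/(W)/(R) themselves,
on `DoorA26`, on `MatrixDescartes` (stmt-ValiantsHypothesis-18050) or on `VP ≠ VNP`; registers unchanged.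

Seat val-sym-door-p2 g12 (W1 #17), `--supports stmt-ValiantsHypothesis-19979 --as helper`. [folklore] Cauchy–Binet / `det_mul`. [this work] packaging.
-/

-- `Summit.ValiantsHypothesis.ValiantsHypothesis.…` repeats a component by the D-0017 layout
-- (single-conjunct summit), which the `dupNamespace` linter flags; the name is mandated.
set_option linter.dupNamespace false

namespace Summit.ValiantsHypothesis.ValiantsHypothesis.Theorems.LacunarySymmetroidMatrixDescartes.WallBubbling

open Matrix Finset Filter Topology
open scoped BigOperators

/-! ## §1 The determinant of a principal `3 × 3` block of a rank-3 shape -/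

/-- **Principal 3-minor of a realisable shape.**  For `G = ε • (v vᵀ − u uᵀ − w wᵀ)` and any selection `S : Fin 3 → Fin 6`,
`det (G_SS) = ε³ · det(B_S)²`, `B = Matrix.of ![v,u,w]`, `B_S = B.submatrix id S`. [folklore] -/
theorem det_principal_three_of_shape (ε : ℝ) (v u w : Fin 6 → ℝ) (G : Matrix (Fin 6) (Fin 6) ℝ)
    (hG : G = ε • (vecMulVec v v - vecMulVec u u - vecMulVec w w)) (S : Fin 3 → Fin 6) :
    (G.submatrix S S).det = ε ^ 3 * ((Matrix.of ![v, u, w]).submatrix id S).det ^ 2 := by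
  have hfac : G = (Matrix.of ![v, u, w])ᵀ * Matrix.diagonal ![ε, -ε, -ε] * Matrix.of ![v, u, w] := by
    rw [hG]; exact mixedParity_gram_eq_factor ε v u w
  have hsub : G.submatrix S S
      = ((Matrix.of ![v, u, w]).submatrix id S)ᵀ * Matrix.diagonal ![ε, -ε, -ε] * (Matrix.of ![v, u, w]).submatrix id S := by
    rw [hfac, mixedParity_submatrix_factor]
  rw [hsub, Matrix.det_mul, Matrix.det_mul, Matrix.det_transpose, Matrix.det_diagonal]
  simp [Fin.prod_univ_three]
  ring

/-- Hence the sign law for a shape: `0 ≤ ε · det (G_SS)` when `ε = ±1`. [folklore] -/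
theorem principal_three_sign_of_shape (ε : ℝ) (hε : ε = 1 ∨ ε = -1) (v u w : Fin 6 → ℝ) (G : Matrix (Fin 6) (Fin 6) ℝ)
    (hG : G = ε • (vecMulVec v v - vecMulVec u u - vecMulVec w w)) (S : Fin 3 → Fin 6) :
    0 ≤ ε * (G.submatrix S S).det := by
  rw [det_principal_three_of_shape ε v u w G hG S]
  have hε4 : ε * ε ^ 3 = 1 := by rcases hε with rfl | rfl <;> norm_num
  calc (0 : ℝ) ≤ ((Matrix.of ![v, u, w]).submatrix id S).det ^ 2 := sq_nonneg _
    _ = ε * (ε ^ 3 * ((Matrix.of ![v, u, w]).submatrix id S).det ^ 2) := by rw [← mul_assoc, hε4, one_mul]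

/-! ## §2 The PM3 row for realisable would-be Gram matrices -/

/-- **PM3 ROW (soundness item).**  For a realisable would-be Gram matrix `G` (the line's `Realisable`: `G = ε · polar(S·, S·)` for symmetric `2 × 2`
letters, `ε = ±1`) there is ONE sign `ε` such that EVERY principal `3 × 3` minor satisfies `0 ≤ ε · det (G_SS)`. [folklore] -/
theorem realisable_principal_three_sign {G : Matrix (Fin 6) (Fin 6) ℝ} (hG : Bubbling.Realisable G) :
    ∃ ε : ℝ, (ε = 1 ∨ ε = -1) ∧ ∀ S : Fin 3 → Fin 6, 0 ≤ ε * (G.submatrix S S).det := by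
  obtain ⟨ε, S, hε, hS, h⟩ := hG
  obtain ⟨v, u, w, hvuw⟩ := realisable_shape S hS ε G (fun a b => by rw [h a b]; rfl)
  exact ⟨ε, hε, fun T => principal_three_sign_of_shape ε hε v u w G hvuw T⟩

/-- **PM3, `ε`-free form**: any two principal `3 × 3` minors of a realisable matrix have non-negative product (all one sign, or zero). [folklore] -/
theorem realisable_principal_three_mul_nonneg {G : Matrix (Fin 6) (Fin 6) ℝ} (hG : Bubbling.Realisable G) (S S' : Fin 3 → Fin 6) :
    0 ≤ (G.submatrix S S).det * (G.submatrix S' S').det := by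
  obtain ⟨ε, hε, hall⟩ := realisable_principal_three_sign hG
  have h1 := hall S
  have h2 := hall S'
  have hε2 : ε * ε = 1 := by rcases hε with rfl | rfl <;> norm_num
  have : (G.submatrix S S).det * (G.submatrix S' S').det = (ε * (G.submatrix S S).det) * (ε * (G.submatrix S' S').det) := by
    calc (G.submatrix S S).det * (G.submatrix S' S').det = (ε * ε) * ((G.submatrix S S).det * (G.submatrix S' S').det) := by
          rw [hε2, one_mul]
      _ = (ε * (G.submatrix S S).det) * (ε * (G.submatrix S' S').det) := by ring
  rw [this]
  exact mul_nonneg h1 h2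

/-- **PM3, sequence form** (what the sieve's tropical balance uses): along a sequence of realisable `G^ν`, two principal 3-minors are never
of opposite strict signs at the same stage — in particular a minor cannot be eventually negative on one selection and eventually positive on
another. [this work] -/
theorem principal_three_sign_persists (G : ℕ → Matrix (Fin 6) (Fin 6) ℝ) (hG : ∀ ν, Bubbling.Realisable (G ν)) (S S' : Fin 3 → Fin 6)
    (hpos : ∀ᶠ ν in atTop, 0 < ((G ν).submatrix S S).det) (hneg : ∀ᶠ ν in atTop, ((G ν).submatrix S' S').det < 0) : False := by
  obtain ⟨ν, h1, h2⟩ := (hpos.and hneg).exists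
  have := realisable_principal_three_mul_nonneg (hG ν) S S'
  nlinarith

end Summit.ValiantsHypothesis.ValiantsHypothesis.Theorems.LacunarySymmetroidMatrixDescartes.WallBubbling
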